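import Summits.BirchSwinnertonDyer.Rank1Residual.X2.GreenbergVatsalTateDatumCofree
import Summits.BirchSwinnertonDyer.Rank1Residual.X2.SelmerCotorsionOfFiniteTorsion
import Literature.NumberTheory.EllipticCurves.GreenbergVatsal2000.TrivialZeroInfiniteIndex
import Literature.NumberTheory.EllipticCurves.GreenbergVatsal2000.TrivialZeroStrictInclusion
import HarnessLib

/-!
# GV p. 15 "`S_{E[p^∞]}(ℚ_∞)` is actually bigger" (registry A137) DERIVED from its printed-strength
# form "infinite index" (A137′) and the Tate uniformisation (A40): the uniqueness of the Tate line

HONEST FRAMING (BSD rank-`≤ 1` residual cell `b2b-bsdres`, home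
`run/shared/lean/b2b/bsd-rank1-residual/`, unit `b2b-bsdres-eisenstein-p2`, class X2 = odd
multiplicative Eisenstein primes; research route, no claim beyond stated classes; nothing booked;
labels are the referee's): the cell deletes the COMBINATION-SHAPED residual classes of the
rank-`≤ 1` BSD formula from PUBLISHED theorems only and TYPES the construction-shaped ones; this is
not "finishing BSD". THEOREMS ONLY (no definition, no named fact, nothing asserted).

## What

The two Literature records of Greenberg–Vatsal p. 15 / Prop. (2.1) p. 20 at a SPLIT multiplicative
prime differ in shape:

* A137 `datumStrictSelmer_lt_datumSelmer_of_split` (gen 12): for Greenberg data `L` with `C`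
  divisible, `#(C ∩ A[p]) = p` and the INERTIA group trivial on `A/C`, `S_A(ℚ_∞)[p]` finite,
  `E(ℚ_∞)[p^∞]` finite ⟹ `S^{str}_A(ℚ_∞) < S_A(ℚ_∞)`;
* A137′ `datumStrictSelmer_relIndex_eq_zero_of_split` (gen 26): same data but with the
  DECOMPOSITION group trivial on `A/C`, a topological generator `γ`, and "`S_A(ℚ_∞)` is
  `Λ`-cotorsion" as a finitely generated torsion dual datum ⟹ `[S_A : S^{str}_A] = ∞`.

This file proves **A137 ⇐ A137′ + A40** (`datumStrictSelmer_lt_datumSelmer_of_split_of_relIndex`),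
closing the gen-26 carry "A137 ⇐ A137′ needs decomposition-trivial `Gr` from inertia-trivial at a
split prime". The three conversions:

1. §1–§2 **Uniqueness of the Tate line.** At an odd split `p ‖ N`, for ANY local datum `C'` whose
   quotient `A/C'` is inertia-trivial, the Tate line `C = ι⁻¹Φ(μ)` (gen 9 `tateDatum`, from A40) is
   CONTAINED in `C'`: a local inertia element `σ₀` with `χ_p(σ₀) = 2` (local Kronecker–Weber, tree
   theorem) acts on `C ≅ μ_{p^∞}` as multiplication by `2` at EVERY level `p^k` (§1, the level-`k`
   form of gen 13's `smul_eq_nsmul_of_cyclotomicCharacter_eq`), so every `c ∈ C` is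
   `c = σ₀c − c ∈ C'`. Since the whole decomposition group moves `A` only inside `C`
   (gen 12 `smul_sub_mem_of_equivariant`, the untwisted parametrisation), it acts trivially on
   `A/C'` (§2 `decomp_smul_gr_eq_of_inertia_of_split`). (With `#(C' ∩ A[p]) = p` this forces
   `C' = C`, which is not needed.)
2. §3 **Cotorsion from `S_A(ℚ_∞)[p]` finite** (the `μ = 0` form of A137's hypothesis): the canonical
   dual `Hom(S_A(ℚ_∞), ℚ/ℤ)` (`datumDualData`) is finitely generated (Nakayama,
   `IsDualPair.module_finite`: `S[𝔪] ⊆ S[p]` finite) and torsion (`X/pX ↪ Hom(S[p], ℚ/ℤ)` finite,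
   Cayley–Hamilton `isTorsion_of_finite_modN`, gen 22).
3. §4 a topological generator exists (`κ` is onto `ℤ_p`), and `relIndex = 0 ≠ 1 = relIndex` of a
   subgroup in itself.

The companion file `X2/ClassClosureOfDerivedTrivialZero` re-threads the X2 terms of record
(`targetA_of_datum_heightFree`, gen 26, 18 binders) with
`hF := datumStrictSelmer_lt_datumSelmer_of_split_of_relIndex hT hInf` — SEVENTEEN registered facts
(A137 is no longer an input of the X2 closure; registry: A137 ↦ DERIVED ⇐ {A137′, A40}).

References: Greenberg–Vatsal 2000 (arXiv:math/9906215) §1 pp. 14–15, §2 pp. 16–17, Prop. (2.1)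
and its proof p. 20, p. 26; Greenberg LNM 1716 §1 p. 60, p. 93, Prop. 5.10 (PDF p. 147); Silverman
*ATAEC* V.3.1, V.5.3; Serre *Local Fields* IV §4 Prop. 17 (χ_p(I_{ℚ_p}) = ℤ_p^×).
-/

noncomputable section

open scoped Classical AddSubgroup

universe u

namespace Summit.BirchSwinnertonDyer.Rank1Residual.X2.TrivialZeroStrictInclusionDerived

open NumberField IsDedekindDomain Field WeierstrassCurve
  Literature.NumberTheory.GaloisRepresentations
  Literature.NumberTheory.EllipticCurves Literature.NumberTheory.EllipticCurves.GreenbergSelmer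
  Literature.NumberTheory.EllipticCurves.GreenbergVatsal2000 IsDedekindDomain.HeightOneSpectrum
  Literature.NumberTheory.EllipticCurves.IwasawaDual
  Summit.BirchSwinnertonDyer.Rank1Residual.X2.GreenbergVatsalTorsion
  Summit.BirchSwinnertonDyer.Rank1Residual.X2.GreenbergVatsalTateDatum
  Summit.BirchSwinnertonDyer.Rank1Residual.X2.GreenbergVatsalTateDatumSign
  Summit.BirchSwinnertonDyer.Rank1Residual.X2.GreenbergVatsalTateDatumTorsion
  Summit.BirchSwinnertonDyer.Rank1Residual.X2.GreenbergVatsalTateDatumCofree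
  Summit.BirchSwinnertonDyer.Rank1Residual.X2.GreenbergVatsalStrictSelmerMultiplicative
  Summit.BirchSwinnertonDyer.Rank1Residual.X2.SelmerCotorsionOfFiniteTorsion
  Summit.BirchSwinnertonDyer.Rank1Residual.X2.MuTransferDerived
  Summit.BirchSwinnertonDyer.Rank1Residual.X2.MuVanishingOfFiniteModP

/-! ## §1. The Tate line `C ≅ μ_{p^∞}`: inertia acts through `χ_p` at every level `p^k` -/

section Tate

variable (W : WeierstrassCurve ℚ) [W.IsElliptic] (p : ℕ) [hp : Fact p.Prime]
  {v : HeightOneSpectrum (𝓞 ℚ)}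
  (Φ : Additive (AlgebraicClosure (v.adicCompletion ℚ))ˣ →+ localPoints W (v.adicCompletion ℚ))
  (hΦ : ∀ (σ : absoluteGaloisGroup (v.adicCompletion ℚ))
    (u : (AlgebraicClosure (v.adicCompletion ℚ))ˣ),
    σ • Φ (Additive.ofMul u) = Φ (Additive.ofMul (Units.map
      (Field.absoluteGaloisGroup.toAlgEquiv (v.adicCompletion ℚ) σ :
        AlgebraicClosure (v.adicCompletion ℚ) →* AlgebraicClosure (v.adicCompletion ℚ)) u)) ∨
    σ • Φ (Additive.ofMul u) = -Φ (Additive.ofMul (Units.map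
      (Field.absoluteGaloisGroup.toAlgEquiv (v.adicCompletion ℚ) σ :
        AlgebraicClosure (v.adicCompletion ℚ) →* AlgebraicClosure (v.adicCompletion ℚ)) u)))
  {q : v.adicCompletion ℚ} (hq0 : q ≠ 0) (hq1 : Valued.v q < 1)
  (hker : ∀ u : (AlgebraicClosure (v.adicCompletion ℚ))ˣ, Φ (Additive.ofMul u) = 0 →
    ∃ a : ℤ, (u : AlgebraicClosure (v.adicCompletion ℚ)) =
      algebraMap (v.adicCompletion ℚ) (AlgebraicClosure (v.adicCompletion ℚ)) q ^ a)
  (hΦI : ∀ σ ∈ absInertia (v.adicCompletion ℚ), ∀ u : (AlgebraicClosure (v.adicCompletion ℚ))ˣ,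
    σ • Φ (Additive.ofMul u) = Φ (Additive.ofMul (Units.map
      (Field.absoluteGaloisGroup.toAlgEquiv (v.adicCompletion ℚ) σ :
        AlgebraicClosure (v.adicCompletion ℚ) →* AlgebraicClosure (v.adicCompletion ℚ)) u)))

omit [W.IsElliptic] hp in
include hq0 hq1 hker in
/-- A `p^k`-torsion point of the Tate datum is `Φ(ζ)` with `ζ ∈ μ_{p^k}`: if `ι c = Φ(ζ)` (`ζ` of
finite order) and `p^k•c = 0` then `ζ^{p^k} ∈ q^ℤ` is a root of unity, hence `ζ^{p^k} = 1`
(`0 < |q|_v < 1`) — the level-`k` form of gen 13's `exists_pow_eq_one_of_mem`.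
[cite: SilvermanATAEC1994, Ch. V Thm. 3.1 (c),(d)] -/
theorem exists_pow_pow_eq_one_of_mem (c : W.geomPrimaryTorsion p)
    (hc : c ∈ (tateDatum W p Φ hΦ).plus) (k : ℕ) (hpc : p ^ k • c = 0) :
    ∃ ζ : (AlgebraicClosure (v.adicCompletion ℚ))ˣ, ζ ^ p ^ k = 1 ∧
      Φ (Additive.ofMul ζ) = pointsMap W (v.adicCompletion ℚ) (c : W.geomPoints) := by
  obtain ⟨ζ, hζfin, hζc⟩ := hc
  refine ⟨ζ, ?_, hζc⟩
  have h0 : Φ (Additive.ofMul (ζ ^ p ^ k)) = 0 := by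
    rw [ofMul_pow, map_nsmul, hζc, ← map_nsmul, hpc, map_zero]
  obtain ⟨a, ha⟩ := hker _ h0
  obtain ⟨n, hn, hζn⟩ := isOfFinOrder_iff_pow_eq_one.1 hζfin
  have h1 : algebraMap (v.adicCompletion ℚ) (AlgebraicClosure (v.adicCompletion ℚ)) q ^
      (a * n) = 1 := by
    rw [zpow_mul, ← ha, zpow_natCast, ← Units.val_pow_eq_pow_val, ← pow_mul, mul_comm, pow_mul,
      hζn, one_pow, Units.val_one]
  have h2 : a * n = 0 := WeierstrassCurve.zpow_algebraMap_eq_one_imp v hq0 hq1 h1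
  have ha0 : a = 0 := by
    rcases mul_eq_zero.mp h2 with h | h
    · exact h
    · exact absurd h (by exact_mod_cast hn.ne')
  rw [ha0, zpow_zero] at ha
  exact Units.ext ha

omit [W.IsElliptic] in
include hq0 hq1 hker hΦI in
/-- **Inertia acts on `C[p^k]` through the cyclotomic character mod `p^k`**: if `σ ∈ I_{ℚ_v}` has
`χ_p(σ) = N` (`N < p^k` a natural number), then `res σ • c = N • c` for every `p^k`-torsion point
`c` of the Tate datum (`ι c = Φ(ζ)`, `σζ = ζ^N`) — the level-`k` form of gen 13's
`smul_eq_nsmul_of_cyclotomicCharacter_eq`. GV p. 14: "`C ≅ μ_{p^∞}`" as an `I_p`-module.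
[cite: GreenbergVatsal2000, §2 pp. 14–15] [cite: SilvermanATAEC1994, Ch. V Thm. 3.1 (c),(d)] -/
theorem smul_eq_nsmul_of_cyclotomicCharacter_eq_of_pow_smul
    {σ : absoluteGaloisGroup (v.adicCompletion ℚ)} (hσ : σ ∈ absInertia (v.adicCompletion ℚ))
    {N k : ℕ} (hN : N < p ^ k)
    (hχ : ((GaloisRep.cyclotomicCharacter (v.adicCompletion ℚ) p σ : ℤ_[p]ˣ) : ℤ_[p]) = N)
    (c : W.geomPrimaryTorsion p) (hc : c ∈ (tateDatum W p Φ hΦ).plus) (hpc : p ^ k • c = 0) :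
    absGaloisRestrict ℚ (v.adicCompletion ℚ) σ • c = N • c := by
  haveI : NeZero ((p : ℕ) : v.adicCompletion ℚ) := ⟨by
    rw [← map_natCast (algebraMap ℚ (v.adicCompletion ℚ))]
    exact (map_ne_zero_iff _ (algebraMap ℚ (v.adicCompletion ℚ)).injective).mpr
      (Nat.cast_ne_zero.mpr hp.out.ne_zero)⟩
  obtain ⟨ζ, hζp, hζc⟩ := exists_pow_pow_eq_one_of_mem W p Φ hΦ hq0 hq1 hker c hc k hpc
  have hζp' : (ζ : AlgebraicClosure (v.adicCompletion ℚ)) ^ p ^ k = 1 := by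
    rw [← Units.val_pow_eq_pow_val, hζp, Units.val_one]
  have hσζ : σ • (ζ : AlgebraicClosure (v.adicCompletion ℚ)) = (ζ : _) ^ N := by
    rw [GaloisRep.cyclotomicCharacter_spec (v.adicCompletion ℚ) p σ _ hζp', hχ, map_natCast,
      ZMod.val_natCast, Nat.mod_eq_of_lt hN]
  have hunit : Units.map (Field.absoluteGaloisGroup.toAlgEquiv (v.adicCompletion ℚ) σ :
      AlgebraicClosure (v.adicCompletion ℚ) →* AlgebraicClosure (v.adicCompletion ℚ)) ζ = ζ ^ N := by
    ext
    rw [Units.coe_map, MonoidHom.coe_coe, ← Field.absoluteGaloisGroup.smul_def, hσζ,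
      Units.val_pow_eq_pow_val]
  -- compare in `E(K̄_v)`
  apply Subtype.ext
  apply pointsMapOfEmb_injective W (closureEmb (K := ℚ) (v.adicCompletion ℚ))
  change pointsMap W (v.adicCompletion ℚ)
      (absGaloisRestrict ℚ (v.adicCompletion ℚ) σ • (c : W.geomPoints)) =
    pointsMap W (v.adicCompletion ℚ) (((N • c : W.geomPrimaryTorsion p)) : W.geomPoints)
  rw [AddSubmonoidClass.coe_nsmul, map_nsmul, ← hζc, ← map_nsmul, ← ofMul_pow, ← hunit,
    ← hΦI σ hσ ζ, hζc]
  exact pointsMap_smul W (v.adicCompletion ℚ) σ (c : W.geomPoints)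

/-! ## §2. Uniqueness of the Tate line: `C ⊆ C'` for every datum `C'` with inertia-trivial quotient -/

omit [W.IsElliptic] in
include hq0 hq1 hker hΦI in
/-- **The Tate line lies in every local datum with inertia-trivial quotient** (odd `p`, `v ∋ p`):
if `x•m − m ∈ C'` for all `x ∈ I_v`, `m ∈ E[p^∞]`, then `C = ι⁻¹Φ(μ) ⊆ C'`. Proof: a local inertia
element `σ₀` with `χ_p(σ₀) = 2` (`exists_mem_absInertia_cyclotomicCharacter_eq_natCast`, local
Kronecker–Weber) acts on `c ∈ C[p^{k+1}]` as `2` (§1), so `c = σ₀c − c ∈ C'`. This is the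
uniqueness of the `G_{ℚ_p}`-stable line of the Tate module read on torsion: GV pp. 14–15 "`C ≅ μ_{p^∞}`,
`D = A/C ≅ ℚ_p/ℤ_p` unramified" — any OTHER candidate line has a RAMIFIED quotient.
[cite: GreenbergVatsal2000, §2 pp. 14–15] [cite: SerreLocalFields1979, Ch. IV §4 Prop. 17] -/
theorem tateDatum_plus_le_of_inertia (hp2 : p ≠ 2) (hpv : ((p : ℕ) : 𝓞 ℚ) ∈ v.asIdeal)
    (N' : LocalDatum ℚ (W.geomPrimaryTorsion p) v)
    (htriv' : ∀ x ∈ inertia v, ∀ m : W.geomPrimaryTorsion p, x • m - m ∈ N'.plus) :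
    (tateDatum W p Φ hΦ).plus ≤ N'.plus := by
  intro c hc
  have hpp : 2 < p := lt_of_le_of_ne hp.out.two_le (Ne.symm hp2)
  -- `c` is killed by `p^(k+1)`, and `2 < p^(k+1)`
  obtain ⟨k, hk⟩ := (AddCommGroup.mem_primaryComponent).1 c.2
  have hk' : p ^ k • c = 0 :=
    Subtype.ext (by rw [AddSubmonoidClass.coe_nsmul, ZeroMemClass.coe_zero]; exact hk)
  have hpc : p ^ (k + 1) • c = 0 := by rw [pow_succ', mul_smul, hk', smul_zero]
  have hN : 2 < p ^ (k + 1) := lt_of_lt_of_le hpp (Nat.le_self_pow (Nat.succ_ne_zero k) p)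
  obtain ⟨σ₀, hσ₀I, hχ⟩ := exists_mem_absInertia_cyclotomicCharacter_eq_natCast p hpv (N := 2)
    (fun h ↦ hp2 ((Nat.prime_dvd_prime_iff_eq hp.out Nat.prime_two).mp h))
  have h2 := smul_eq_nsmul_of_cyclotomicCharacter_eq_of_pow_smul W p Φ hΦ hq0 hq1 hker hΦI hσ₀I
    hN hχ c hc hpc
  have hmem := htriv' (absGaloisRestrict ℚ (v.adicCompletion ℚ) σ₀)
    (Subgroup.mem_map_of_mem _ hσ₀I) c
  rwa [h2, two_nsmul, add_sub_cancel_right] at hmem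

end Tate

/-! ## §2'. At a SPLIT prime: inertia-trivial quotient ⟹ decomposition-trivial quotient -/

section Split

variable (W : WeierstrassCurve ℚ) [W.IsElliptic] (p : ℕ) [hp : Fact p.Prime]

/-- **At an odd SPLIT `p ‖ N`, every Greenberg datum of `E[p^∞]` with INERTIA-trivial quotient has
DECOMPOSITION-trivial quotient** (granted the Tate uniformisation A40, `hT`): by §2 the Tate line
`C` of the untwisted parametrisation at `v` lies in `C' = (L v hv).plus`, and the whole of `Γ_{ℚ_v}`
moves `E[p^∞]` only inside `C` (gen 12 `smul_sub_mem_of_equivariant`: "`D ≅ ℚ_p/ℤ_p` with trivial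
action", GV p. 14), hence acts trivially on `E[p^∞]/C'`. This is the hypothesis `hD` of the record
`datumStrictSelmer_relIndex_eq_zero_of_split` (A137′) obtained from the hypothesis `hD` of
`datumStrictSelmer_lt_datumSelmer_of_split` (A137).
[cite: GreenbergVatsal2000, §2 pp. 14–15] [cite: SilvermanATAEC1994, Ch. V Thm. 3.1 (c),(d) and Thm. 5.3 (a),(b)] -/
theorem decomp_smul_gr_eq_of_inertia_of_split (hT : Silverman1994_thmV53_tateUniformisation.{0})
    (hp2 : p ≠ 2) (hsplit : W.HasSplitMultiplicativeReductionAtPrime p)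
    (L : Data ℚ (W.geomPrimaryTorsion p) p)
    (htriv : ∀ (v : HeightOneSpectrum (𝓞 ℚ)) (hv : ((p : ℕ) : 𝓞 ℚ) ∈ v.asIdeal),
      ∀ x ∈ inertia v, ∀ m : W.geomPrimaryTorsion p, x • m - m ∈ (L v hv).plus) :
    ∀ (v : HeightOneSpectrum (𝓞 ℚ)) (hv : ((p : ℕ) : 𝓞 ℚ) ∈ v.asIdeal),
      ∀ (δ : decomp (K := ℚ) v) (d : (L v hv).Gr), δ • d = d := by
  intro v hv δ d
  obtain ⟨q, Φ, hq0, hq1, hsurj, hker, hΦσ, -⟩ :=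
    hT W v (hasSplitMultiplicativeReductionAt_of_mem W p hsplit hv)
  have hle : (tateDatum W p Φ (sign_disj W Φ 0 (sign_of_equivariant W Φ hΦσ))).plus ≤
      (L v hv).plus :=
    tateDatum_plus_le_of_inertia W p Φ _ hq0 hq1 (fun u h ↦ (hker u).1 h) (fun σ _ u ↦ hΦσ σ u)
      hp2 hv (L v hv) (htriv v hv)
  obtain ⟨m, rfl⟩ := (L v hv).grMk_surjective d
  obtain ⟨σ, hσ⟩ := (mem_decomp_iff v (δ : absoluteGaloisGroup ℚ)).1 δ.2
  rw [LocalDatum.smul_grMk, ← sub_eq_zero, ← map_sub, ← AddMonoidHom.mem_ker, LocalDatum.ker_grMk,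
    ← hσ]
  exact hle (smul_sub_mem_of_equivariant W p Φ hΦσ hsurj (fun u h ↦ (hker u).1 h) σ m)

/-- Packaged with the Tate line: under the same hypotheses BOTH the inclusion of a Tate line in
`(L v hv).plus` at every `v ∋ p` and the `D_v`-triviality of the quotient hold. Bookkeeping form of
§2 for consumers that also want `C ⊆ C'`. [cite: GreenbergVatsal2000, §2 pp. 14–15] -/
theorem exists_tate_le_of_inertia_of_split (hT : Silverman1994_thmV53_tateUniformisation.{0})
    (hp2 : p ≠ 2) (hsplit : W.HasSplitMultiplicativeReductionAtPrime p)
    (L : Data ℚ (W.geomPrimaryTorsion p) p)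
    (htriv : ∀ (v : HeightOneSpectrum (𝓞 ℚ)) (hv : ((p : ℕ) : 𝓞 ℚ) ∈ v.asIdeal),
      ∀ x ∈ inertia v, ∀ m : W.geomPrimaryTorsion p, x • m - m ∈ (L v hv).plus)
    (v : HeightOneSpectrum (𝓞 ℚ)) (hv : ((p : ℕ) : 𝓞 ℚ) ∈ v.asIdeal) :
    ∃ N : LocalDatum ℚ (W.geomPrimaryTorsion p) v,
      (∀ (σ : absoluteGaloisGroup (v.adicCompletion ℚ)) (m : W.geomPrimaryTorsion p),
        absGaloisRestrict ℚ (v.adicCompletion ℚ) σ • m - m ∈ N.plus) ∧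
      N.plus ≤ (L v hv).plus := by
  obtain ⟨q, Φ, hq0, hq1, hsurj, hker, hΦσ, -⟩ :=
    hT W v (hasSplitMultiplicativeReductionAt_of_mem W p hsplit hv)
  exact ⟨tateDatum W p Φ (sign_disj W Φ 0 (sign_of_equivariant W Φ hΦσ)),
    smul_sub_mem_of_equivariant W p Φ hΦσ hsurj (fun u h ↦ (hker u).1 h),
    tateDatum_plus_le_of_inertia W p Φ _ hq0 hq1 (fun u h ↦ (hker u).1 h) (fun σ _ u ↦ hΦσ σ u)
      hp2 hv (L v hv) (htriv v hv)⟩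

end Split

/-! ## §3. `S^{S₀}_A(K_∞)[p]` finite ⟹ the canonical dual is finitely generated and torsion -/

section Cotorsion

variable {K : Type u} [Field K] [NumberField K] (W : WeierstrassCurve K) {p : ℕ} [hp : Fact p.Prime]
  (κ : ZpExtension K p) {γ : absoluteGaloisGroup K}

/-- **`S^{S₀}_{E[p^∞]}(K_∞)[p]` finite ⟹ `Hom(S^{S₀}_{E[p^∞]}(K_∞), ℚ/ℤ)` is a finitely generated
TORSION `Λ`-module** (for any `ℤ_p`-extension `κ` with topological generator `γ` and any Greenberg
data `L`, set `S₀`): finitely generated by Nakayama (`IsDualPair.module_finite`: the piece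
`S[p] ∩ S^{γ=1} ⊆ S[p]` is finite), torsion because `X/pX ↪ Hom(S[p], ℚ/ℤ)` is finite
(`finite_modN_characterModule_of_finite_torsionBy`) and a finitely generated `Λ`-module with `X/pX`
finite is torsion (`isTorsion_of_finite_modN`, Cayley–Hamilton). GV p. 25: "`S^{Σ₀}_A(ℚ_∞)` is
`Λ`-cotorsion and has `μ`-invariant `0` if and only if `S^{Σ₀}_A(ℚ_∞)[π]` is finite" — the "if"
half (cotorsion part) in the kernel. [cite: GreenbergVatsal2000, §2 p. 25]
[cite: GreenbergLNM1716, §1 p. 60 and Prop. 5.10 (proof, PDF p. 147)] -/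
theorem moduleFinite_and_isTorsion_datumDualData_of_finite_torsionBy (hγ : κ.IsTopGenerator γ)
    (L : Data K (W.geomPrimaryTorsion p) p) (S₀ : Set (HeightOneSpectrum (𝓞 K)))
    [hA : Finite ↥(datumSelmerInfty κ (W.geomPrimaryTorsion p) L S₀ ⊓
      (subgroupH1 κ.kerSubgroup (W.geomPrimaryTorsion p))[(p : ℤ)])] :
    Module.Finite (IwasawaAlgebra p) (datumDualData W κ L S₀ hγ).X ∧
      Module.IsTorsion (IwasawaAlgebra p) (datumDualData W κ L S₀ hγ).X := by
  set S := datumSelmerInfty κ (W.geomPrimaryTorsion p) L S₀ with hS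
  -- `S[p]` (inside the subtype) is finite: it injects into `S ⊓ H¹[p]`
  let j : (↥S)[(p : ℤ)] → ↥(S ⊓ (subgroupH1 κ.kerSubgroup (W.geomPrimaryTorsion p))[(p : ℤ)]) :=
    fun t ↦ ⟨((t : S) : subgroupH1 κ.kerSubgroup (W.geomPrimaryTorsion p)),
      ⟨(t : S).2, AddSubgroup.torsionBy.nsmul_iff.mpr (by
        have ht : p • (t : S) = 0 := AddSubgroup.torsionBy.nsmul_iff.mp t.2
        rw [← AddSubgroupClass.coe_nsmul, ht, ZeroMemClass.coe_zero])⟩⟩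
  haveI hSp : Finite ((↥S)[(p : ℤ)]) :=
    Finite.of_injective j fun t t' h ↦ Subtype.ext (Subtype.ext (congrArg (fun z ↦ (z.1 : _)) h))
  -- the dual pair
  have hpair : IsDualPair p (conjDatum W κ L S₀ γ - 1) (datumDualData W κ L S₀ hγ).toDual :=
    { bijective := (datumDualData W κ L S₀ hγ).bijective
      T_smul := fun x s ↦ by
        rw [(datumDualData W κ L S₀ hγ).toDual_T_smul, IwasawaDual.End_sub_apply,
          AddMonoid.End.one_apply, map_sub]
        rfl
      C_smul := fun c x s k hk ↦ (datumDualData W κ L S₀ hγ).toDual_C_smul c x s k hk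
      locNil := isLocNil_conjDatum_sub_one W κ L S₀ hγ }
  -- Nakayama: `S[𝔪] ⊆ S[p]` is finite
  have hfg : Module.Finite (IwasawaAlgebra p) (datumDualData W κ L S₀ hγ).X := by
    refine hpair.module_finite ((Set.finite_univ_iff.mpr hSp).image
      (fun t : (↥S)[(p : ℤ)] ↦ (t : S)) |>.subset fun s hs ↦ ?_)
    have hs1 := (mem_piece.mp hs).1
    rw [pow_one] at hs1
    exact ⟨⟨s, AddSubgroup.torsionBy.nsmul_iff.mpr hs1⟩, Set.mem_univ _, rfl⟩
  haveI := hfg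
  -- `X/pX` is finite (`X = Hom(S, ℚ/ℤ)` literally), hence `X` is torsion
  haveI : Finite (ModN (CharacterModule ↥S) p) := finite_modN_characterModule_of_finite_torsionBy p
  haveI : Finite (ModN (datumDualData W κ L S₀ hγ).X p) := ‹Finite (ModN (CharacterModule ↥S) p)›
  exact ⟨hfg, isTorsion_of_finite_modN p (datumDualData W κ L S₀ hγ).X⟩

end Cotorsion

/-! ## §4. A137 DERIVED from A137′ and A40 -/

/-- **Greenberg–Vatsal p. 15 "`S_{E[p^∞]}(ℚ_∞)` is actually bigger" (the record
`datumStrictSelmer_lt_datumSelmer_of_split`, registry A137) is a THEOREM given the printed-strength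
record `datumStrictSelmer_relIndex_eq_zero_of_split` (A137′: infinite index, under Prop. (2.1)'s
printed hypotheses) and the Tate uniformisation (Silverman *ATAEC* V.3.1/V.5.3, A40).** Given A137's
data — `p` odd split multiplicative, `κ` cyclotomic, `L` with `C` divisible, `#(C ∩ A[p]) = p`,
inertia trivial on `A/C`, `S_A(ℚ_∞)[p]` finite, `E(ℚ_∞)[p^∞]` finite —: pick a topological
generator `γ` (§4), upgrade "inertia trivial" to "decomposition trivial" by the uniqueness of the
Tate line (§2, from A40), upgrade "`S_A(ℚ_∞)[p]` finite" to "the canonical dual is f.g. torsion"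
(§3), apply A137′ to get `[S_A : S^{str}_A] = ∞`, whence `S^{str}_A ≠ S_A` (`relIndex_self = 1`) and
`S^{str}_A < S_A`. Registry consequence: A137 ↦ DERIVED ⇐ {A137′, A40}.
[cite: GreenbergVatsal2000, §1 pp. 14–15; §2 Prop. (2.1) p. 17 and its proof p. 20; p. 25; p. 26]
[cite: SilvermanATAEC1994, Ch. V Thm. 3.1 (c),(d) and Thm. 5.3 (a),(b)] -/
theorem datumStrictSelmer_lt_datumSelmer_of_split_of_relIndex
    (hT : Silverman1994_thmV53_tateUniformisation.{0})
    (hInf : datumStrictSelmer_relIndex_eq_zero_of_split) :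
    datumStrictSelmer_lt_datumSelmer_of_split := by
  intro W _ p _ hp2 hsplit κ hκ L hC hD hA hfix
  obtain ⟨γ, hγ⟩ : ∃ γ : absoluteGaloisGroup ℚ, κ.IsTopGenerator γ :=
    κ.surjective (Multiplicative.ofAdd 1)
  have hDD := decomp_smul_gr_eq_of_inertia_of_split W p hT hp2 hsplit L hD
  haveI := hA
  obtain ⟨hfg, htors⟩ :=
    moduleFinite_and_isTorsion_datumDualData_of_finite_torsionBy W κ hγ L
      (∅ : Set (HeightOneSpectrum (𝓞 ℚ)))
  haveI := hfg
  have h0 := hInf W p hp2 hsplit κ hκ γ hγ L hC hDD (datumDualData W κ L ∅ hγ) htors hfix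
  refine lt_of_le_of_ne (datumStrictSelmerInfty_le_datumSelmerInfty κ _ L ∅) fun heq ↦ ?_
  rw [heq, AddSubgroup.relIndex_self] at h0
  exact one_ne_zero h0

end Summit.BirchSwinnertonDyer.Rank1Residual.X2.TrivialZeroStrictInclusionDerived

end

/-! ## §5 (appended, gen 27). The trivial-zero quotient is INFINITE under A137's hypotheses
(A137′'s conclusion in the inertia / `μ = 0` vocabulary of `TrivialZeroQuotient`; A40 + A137′) -/

noncomputable section

open scoped Classical AddSubgroup

namespace Summit.BirchSwinnertonDyer.Rank1Residual.X2.TrivialZeroStrictInclusionDerived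

open NumberField IsDedekindDomain Field Literature.NumberTheory.GaloisRepresentations
  Literature.NumberTheory.EllipticCurves Literature.NumberTheory.EllipticCurves.GreenbergSelmer
  Literature.NumberTheory.EllipticCurves.GreenbergVatsal2000

/-- **`S_A(ℚ_∞)/S^{str}_A(ℚ_∞)` is INFINITE at an odd SPLIT `p ‖ N` under the hypotheses of A137**
(`C` divisible, `#(C ∩ A[p]) = p`, INERTIA trivial on `A/C`, `S_A(ℚ_∞)[p]` finite, `E(ℚ_∞)[p^∞]`
finite), granted A40 (`hT`) and A137′ (`hInf`): §2 (decomposition-trivial), §3 (cotorsion), A137′,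
`AddSubgroup.index_eq_zero_iff_infinite`.
[cite: GreenbergVatsal2000, §1 pp. 14–15; §2 Prop. (2.1) p. 17 and its proof p. 20; p. 25; p. 26]
[cite: SilvermanATAEC1994, Ch. V Thm. 3.1 (c),(d) and Thm. 5.3 (a),(b)] -/
theorem infinite_quotient_of_split_of_inertia
    (hT : Silverman1994_thmV53_tateUniformisation.{0})
    (hInf : datumStrictSelmer_relIndex_eq_zero_of_split)
    (W : WeierstrassCurve ℚ) [W.IsElliptic] (p : ℕ) [Fact p.Prime] (hp2 : p ≠ 2)
    (hsplit : W.HasSplitMultiplicativeReductionAtPrime p)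
    (κ : ZpExtension ℚ p) (hκ : κ.IsCyclotomic) (L : Data ℚ (W.geomPrimaryTorsion p) p)
    (hC : ∀ (v : HeightOneSpectrum (𝓞 ℚ)) (hv : ((p : ℕ) : 𝓞 ℚ) ∈ v.asIdeal),
      (∀ c ∈ (L v hv).plus, ∃ c' ∈ (L v hv).plus, p • c' = c) ∧
        Nat.card ↥((L v hv).plus ⊓ (↥(W.geomPrimaryTorsion p))[(p : ℤ)]) = p)
    (hD : ∀ (v : HeightOneSpectrum (𝓞 ℚ)) (hv : ((p : ℕ) : 𝓞 ℚ) ∈ v.asIdeal),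
      ∀ x ∈ inertia v, ∀ m : W.geomPrimaryTorsion p, x • m - m ∈ (L v hv).plus)
    (hA : Finite ↥(datumSelmerInfty κ (W.geomPrimaryTorsion p) L ∅ ⊓
        (subgroupH1 κ.kerSubgroup (W.geomPrimaryTorsion p))[(p : ℤ)]))
    (hfix : Finite ↥(FixedPoints.addSubgroup κ.kerSubgroup (W.geomPrimaryTorsion p))) :
    Infinite (datumSelmerInfty κ (W.geomPrimaryTorsion p) L ∅ ⧸
      (datumStrictSelmerInfty κ (W.geomPrimaryTorsion p) L ∅).addSubgroupOf
        (datumSelmerInfty κ (W.geomPrimaryTorsion p) L ∅)) := by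
  obtain ⟨γ, hγ⟩ : ∃ γ : absoluteGaloisGroup ℚ, κ.IsTopGenerator γ :=
    κ.surjective (Multiplicative.ofAdd 1)
  haveI := hA
  obtain ⟨hfg, htors⟩ := moduleFinite_and_isTorsion_datumDualData_of_finite_torsionBy W κ hγ L
    (∅ : Set (HeightOneSpectrum (𝓞 ℚ)))
  exact AddSubgroup.index_eq_zero_iff_infinite.mp (@hInf W _ p _ hp2 hsplit κ hκ γ hγ L hC
    (decomp_smul_gr_eq_of_inertia_of_split W p hT hp2 hsplit L hD) _ hfg htors hfix)

end Summit.BirchSwinnertonDyer.Rank1Residual.X2.TrivialZeroStrictInclusionDerived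

end
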